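import Literature.Computability.FineGrained.NSETHNonReducibilityAPSP
import HarnessLib

/-!
# NSETH non-reducibility to APSP: keeping the queried instances

A sibling of `Literature.Computability.FineGrained.NSETHNonReducibilityAPSP` (the decomposition of
`not_fgReducible_cnfSATWithSize_apsp_of_nseth`, **fine-grained.S20** for APSP, along the chain of the
3SUM file `NSETHNonReducibility.lean`). There, step 1 turns a fine-grained reduction
`(CNFSATWithSize c, 2ⁿ) ≤_FG (APSP c', b)` into an APSP-oracle word-RAM program
(`CNFSATInAPSPOracleRAMTime c ρ`) and forgets, along with the ledger, WHICH word lists the program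
queries. A fine-grained reduction, however, queries only encodings of instances of its target problem
(`FGReducible`: `c.queries = bs.map B.encode`; V. Vassilevska Williams, ICM 2018, Def. 2.1 names the
queried instances `y₁, …, y_q`), and this is exactly what the missing step 2 (the change of machine
model, or the in-RAM elimination of the oracle) needs in order to answer the queries with an APSP
*algorithm* — specified on instances only: weights in `[-m^{c'}, m^{c'}]`, no negative cycle; e.g. the
verified cubic word-RAM program of `APSP_inTimeO_cube_holds` (`APSPWordRAM.lean`) — rather than with
a program for the total function `apspOracle`. This file keeps that guarantee
(`CNFSATInAPSPOracleRAMTimeValid c c' ρ`), proves step 1 in this form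
(`cnfSATInAPSPOracleRAMTimeValid_of_fgReducible`) and restates the two assemblies with the
correspondingly WEAKER hypotheses (`not_fgReducible_cnfSATWithSize_apsp_of_nseth_of_validBridge`,
`…_of_validOracleElim`) — the forms a proving seat should target. Everything here is proved; no named
fact is introduced.

## References

* M. L. Carmosino, J. Gao, R. Impagliazzo, I. Mihajlin, R. Paturi, S. Schneider, ITCS 2016, §3
  Lemma 1, §5 Thm. 2–3. [key `CarmosinoEtAlITCS2016`]
* V. Vassilevska Williams, Proc. ICM 2018, §2, Def. 2.1. [key `VassilevskaWilliamsICM2018`]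
* S. A. Cook, R. A. Reckhow, JCSS 7 (1973), §2. [key `CookReckhow1973`]
-/

namespace Literature.Computability.FineGrained

open Cryptography Cryptography.WordRAM Complexity

/-! ### Keeping the queried instances

`CNFSATInAPSPOracleRAMTime` forgets, along with the ledger, WHICH word lists the program queries.
A fine-grained reduction, however, queries only encodings of instances of its target problem
(`FGReducible`: `c.queries = bs.map B.encode`, VVW ICM 2018, Def. 2.1 names the queried instances
`y₁, …, y_q`), and this is exactly what a simulator needs in order to answer the queries with an APSP
*algorithm*, which is specified on instances only (weights in `[-m^{c'}, m^{c'}]`, no negative cycle —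
e.g. the verified cubic word-RAM program of `APSP_inTimeO_cube_holds`), rather than with a program
computing the total function `apspOracle`. The variant `CNFSATInAPSPOracleRAMTimeValid c c' ρ` keeps
this guarantee; step 1 holds in this form too (`cnfSATInAPSPOracleRAMTimeValid_of_fgReducible`), and
the assemblies are restated with the correspondingly WEAKER hypotheses
(`…_of_validBridge`, `…_of_validOracleElim`), which are the ones a proving seat should target. -/

/-- `CNFSATInAPSPOracleRAMTimeValid c c' ρ`: as `CNFSATInAPSPOracleRAMTime c ρ` — a deterministic
word-RAM oracle program deciding the instances of `CNFSATWithSize c` with the canonical APSP oracle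
`apspOracle` within `⌊C · 2^{ρ n} + C⌋₊` steps at word size `k · inputWidth (encodeCNFWords φ)` —
and, in addition, every query in the log of the halting configuration is the encoding of an instance
of `APSP c'` (weights in `[-m^{c'}, m^{c'}]`, no negative cycle), as Def. 2.1 of VVW ICM 2018
stipulates for the queries of a fine-grained reduction to `(APSP c', b)`.
[cite: VassilevskaWilliamsICM2018, §2 Def. 2.1] -/
def CNFSATInAPSPOracleRAMTimeValid (c c' : ℕ) (ρ : ℝ) : Prop :=
  ∃ (M : Program) (k : ℕ) (C : ℝ), M.IsDeterministic ∧
    ∀ φ : CNF ℕ, φ.numClauses + φ.size ≤ (φ.numVars + 1) ^ c →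
      ∃ cfg : Cfg, HaltsWithin M (k * inputWidth (encodeCNFWords φ)) apspOracle zeroCoins
          (encodeCNFWords φ) ⌊C * (2 : ℝ) ^ (ρ * (φ.numVars : ℝ)) + C⌋₊ cfg ∧
        readOut cfg.mem ∈ CNFSAT.Good φ ∧
        ∀ q ∈ cfg.queries, ∃ y : (APSP c').Inst, q = (APSP c').encode y

/-- Forgetting the queried instances. [folklore] -/
theorem CNFSATInAPSPOracleRAMTimeValid.forget {c c' : ℕ} {ρ : ℝ}
    (h : CNFSATInAPSPOracleRAMTimeValid c c' ρ) : CNFSATInAPSPOracleRAMTime c ρ := by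
  obtain ⟨M, k, C, hdet, hM⟩ := h
  refine ⟨M, k, C, hdet, fun φ hφ => ?_⟩
  obtain ⟨cfg, hrun, hout, -⟩ := hM φ hφ
  exact ⟨cfg, hrun, hout⟩

/-- Monotonicity of `CNFSATInAPSPOracleRAMTimeValid` in the exponent. [folklore] -/
theorem CNFSATInAPSPOracleRAMTimeValid.mono {c c' : ℕ} {ρ ρ' : ℝ}
    (h : CNFSATInAPSPOracleRAMTimeValid c c' ρ) (hρ : ρ ≤ ρ') :
    CNFSATInAPSPOracleRAMTimeValid c c' ρ' := by
  obtain ⟨M, k, C, hdet, hM⟩ := h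
  refine ⟨M, k, max C 0, hdet, fun φ hφ => ?_⟩
  obtain ⟨cfg, hrun, hout, hq⟩ := hM φ hφ
  refine ⟨cfg, hrun.mono (Nat.floor_le_floor ?_), hout, hq⟩
  have h0 : (0 : ℝ) ≤ max C 0 := le_max_right _ _
  have h1 : (0 : ℝ) ≤ (2 : ℝ) ^ (ρ * (φ.numVars : ℝ)) := by positivity
  have h2 : (2 : ℝ) ^ (ρ * (φ.numVars : ℝ)) ≤ (2 : ℝ) ^ (ρ' * (φ.numVars : ℝ)) :=
    Real.rpow_le_rpow_of_exponent_le (by norm_num)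
      (mul_le_mul_of_nonneg_right hρ (Nat.cast_nonneg _))
  calc C * (2 : ℝ) ^ (ρ * (φ.numVars : ℝ)) + C
      ≤ max C 0 * (2 : ℝ) ^ (ρ * (φ.numVars : ℝ)) + max C 0 :=
        add_le_add (mul_le_mul_of_nonneg_right (le_max_left _ _) h1) (le_max_left _ _)
    _ ≤ max C 0 * (2 : ℝ) ^ (ρ' * (φ.numVars : ℝ)) + max C 0 := by gcongr

/-- **Step 1, keeping the queried instances (proved).** A fine-grained reduction
`(CNFSATWithSize c, 2ⁿ) ≤_FG (APSP c', b)`, taken at `ε = 1` with the canonical oracle, is an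
APSP-oracle program of some exponent `0 ≤ ρ < 1` all of whose queries encode `APSP c'` instances
(`FGReducible` provides `c.queries = bs.map (APSP c').encode`). (Carmosino et al. 2016, §3 Lemma 1;
VVW ICM 2018, Def. 2.1.) [cite: CarmosinoEtAlITCS2016, §3 Lemma 1] -/
theorem cnfSATInAPSPOracleRAMTimeValid_of_fgReducible {c c' : ℕ} {b : ℕ → ℝ}
    (h : FGReducible (CNFSATWithSize c) (fun n => (2 : ℝ) ^ (n : ℝ)) (APSP c') b) :
    ∃ ρ : ℝ, 0 ≤ ρ ∧ ρ < 1 ∧ CNFSATInAPSPOracleRAMTimeValid c c' ρ := by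
  obtain ⟨δ, hδ, M, k, C, hdet, hM⟩ := h 1 one_pos
  refine ⟨1 - min δ 1, by have := min_le_right δ 1; linarith,
    by have := lt_min hδ one_pos; linarith, M, k, max C 0, hdet, fun φ hφ => ?_⟩
  obtain ⟨cfg, bs, hrun, hgood, hqs, -, -⟩ :=
    hM apspOracle (APSP_oracleAnswers_apspOracle c') ⟨φ, hφ⟩
  refine ⟨cfg, hrun.mono (Nat.floor_le_floor ?_), hgood, fun q hq => ?_⟩
  swap
  · rw [hqs] at hq
    obtain ⟨y, -, rfl⟩ := List.mem_map.1 hq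
    exact ⟨y, rfl⟩
  show C * ((2 : ℝ) ^ ((φ.numVars : ℕ) : ℝ)) ^ (1 - δ) + C ≤
    max C 0 * (2 : ℝ) ^ ((1 - min δ 1) * (φ.numVars : ℝ)) + max C 0
  rw [← Real.rpow_mul (by norm_num : (0 : ℝ) ≤ 2)]
  have h0 : (0 : ℝ) ≤ max C 0 := le_max_right _ _
  have h1 : (0 : ℝ) ≤ (2 : ℝ) ^ ((φ.numVars : ℝ) * (1 - δ)) := by positivity
  have h2 : (2 : ℝ) ^ ((φ.numVars : ℝ) * (1 - δ)) ≤
      (2 : ℝ) ^ ((1 - min δ 1) * (φ.numVars : ℝ)) := by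
    refine Real.rpow_le_rpow_of_exponent_le (by norm_num) ?_
    rw [mul_comm]
    exact mul_le_mul_of_nonneg_right (by have := min_le_left δ 1; linarith) (Nat.cast_nonneg _)
  calc C * (2 : ℝ) ^ ((φ.numVars : ℝ) * (1 - δ)) + C
      ≤ max C 0 * (2 : ℝ) ^ ((φ.numVars : ℝ) * (1 - δ)) + max C 0 :=
        add_le_add (mul_le_mul_of_nonneg_right (le_max_left _ _) h1) (le_max_left _ _)
    _ ≤ max C 0 * (2 : ℝ) ^ ((1 - min δ 1) * (φ.numVars : ℝ)) + max C 0 := by gcongr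

/-- **Route (a) with the weaker hypothesis (proved):** it suffices to change the machine model for
APSP-oracle programs *all of whose queries are `APSP c'` instances* — the simulating multi-stack
machine then answers each query by an APSP algorithm on a genuine instance of `poly(n)` size
(`length_apspOracle_le`, `WordRAM.run_memLE_of_queries`), Cook–Reckhow 1973, §2, with polynomial
overhead per step. [cite: CarmosinoEtAlITCS2016, §5 Thm. 2–3 (APSP)] -/
theorem not_fgReducible_cnfSATWithSize_apsp_of_nseth_of_validBridge
    (h2 : ∀ (c c' : ℕ) (ρ : ℝ), 2 ≤ c → 0 ≤ ρ → CNFSATInAPSPOracleRAMTimeValid c c' ρ →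
      ∀ (k c'' : ℕ) (η : ℝ), 0 < η → SparseKSATInExpTime k c'' (ρ + η)) :
    not_fgReducible_cnfSATWithSize_apsp_of_nseth := by
  intro hN c hc c' hred
  obtain ⟨ρ, hρ0, hρ1, hram⟩ := cnfSATInAPSPOracleRAMTimeValid_of_fgReducible hred
  have hη : 0 < (1 - ρ) / 2 := by linarith
  obtain ⟨k, -, hnot⟩ := hN ((1 - ρ) / 2) hη
  have hsat : KSATInExpTime k (ρ + (1 - ρ) / 2) :=
    kSATInExpTime_of_sparseKSATInExpTime_of_exponent hρ0
      (fun c'' η hη' => h2 c c' ρ hc hρ0 hram k c'' η hη') _ hη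
  have e : ρ + (1 - ρ) / 2 = 1 - (1 - ρ) / 2 := by ring
  rw [e] at hsat
  exact hnot (kTAUTInNExpTime_of_kSATInExpTime_holds hsat)

/-- **Route (b) with the weaker hypothesis (proved):** it suffices to eliminate the APSP oracle
inside the word RAM for programs *all of whose queries are `APSP c'` instances* — answering each query
by an inline run of an `APSP c'` algorithm, e.g. the verified cubic program of
`APSP_inTimeO_cube_holds` —, after which the sibling's existing named fact
`sparseKSATInExpTime_of_cnfSATInThreeSumOracleRAMTime` closes the target.
[cite: CarmosinoEtAlITCS2016, §5 Thm. 2–3 (APSP)] -/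
theorem not_fgReducible_cnfSATWithSize_apsp_of_nseth_of_validOracleElim
    (helim : ∀ (c c' : ℕ) (ρ : ℝ), 0 ≤ ρ → CNFSATInAPSPOracleRAMTimeValid c c' ρ →
      ∀ η : ℝ, 0 < η → CNFSATInThreeSumOracleRAMTime c (ρ + η))
    (h3 : sparseKSATInExpTime_of_cnfSATInThreeSumOracleRAMTime) :
    not_fgReducible_cnfSATWithSize_apsp_of_nseth := by
  intro hN c hc c' hred
  obtain ⟨ρ, hρ0, hρ1, hram⟩ := cnfSATInAPSPOracleRAMTimeValid_of_fgReducible hred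
  have hη : 0 < (1 - ρ) / 4 := by linarith
  have hram' : CNFSATInThreeSumOracleRAMTime c (ρ + (1 - ρ) / 4) := helim c c' ρ hρ0 hram _ hη
  refine not_nseth_of_cnfSATInThreeSumOracleRAMTime h3
    (fun k ρ' hρ' h η hη' => kSATInExpTime_of_sparseKSATInExpTime_of_exponent hρ' h η hη')
    kTAUTInNExpTime_of_kSATInExpTime_holds hc (by linarith) (by linarith) hram' hN

end Literature.Computability.FineGrained
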